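/-
Copyright: the b2b-balaban cell (near-miss cell 7), T⁴-continuum fan-out; row NE7b ROUND-2 swarm, seat
t4-ne7b-formalise-leaf-05 gen 2 (row S6g′ binding of `t4/b2b-balaban-t4-ne7b-p1/LEAVES-NE7b.md`, owner's ruling R-OWNER-22-12 (2)).
Released under the licence of the surrounding project.
-/
import Summits.QuantumFields.BalabanUV.T4Continuum.Support.HistoryJoinsAdm

/-!
# History joins, part 3: the COUNT — one join of the shape tree costs `(Σ M)^{r−1}·∏ NZ ∕ ∏ k_g!` (row S6g′, binding)

Summits-side support leaf of the T⁴-continuum cell (rung (B)+1 on a FINITE torus only; NOT infinite volume, NOT the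
mass gap, NOT the Clay statement; NOT a proof of the spine estimate NE7b).  Row NE7b, route «COUNT»; row S6g′, the
binding: the generic layer (c) (`HistorySiblingSymmetry` forest hull, `HistorySiblingCanon` sorted representatives)
APPLIED to the top join of a merger of the shape tree with address placements (`HistoryJoinsAdm`).  [folklore] finite
combinatorics over the lineage's own carrier with DISPLAYED zone data; nothing is quoted from print, nothing printed is
asserted, no `[cite:]` tag, no `Prop` fact of Bałaban's.

THE DISPLAYED DATA (as in `ZoneSkeleton`; rows S6g′(a)(b) instantiate them): the zone map `zone t Z p` and sort key
`ρ` of part 2; a CARDINALITY majorant `M t Z` of the zone of an admissibly placed `Z` at step `t` (row (a): the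
decayed mass law); a ROOT-LOCALITY radius `ext t Z` with a nearness relation `near u t y s r` («the scale-`s` cell `y`,
blocked to step `t`, is within `r` of the block `u`») satisfied by the root cell of any admissibly placed `Z` whose zone
holds `u` (the extent law); and the one-block ROOT COUNT `#{y | near u t y s r} ≤ NZ r t s` (row (b):
`HistoryMassPlacementTorus.card_touchT_le`, `(2r+1)^d·Λ^{t+1−s}`).  All three laws are asked for ADMISSIBLE placements
only (`Sany`) — decayed cardinality and extent hold for connected placements, not for junk.

THE THEOREM (`Wn_merge_mul_symFac_le`).  For a merger `G = merge X Y e` of step `t = st e` with top-join parts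
`part i` (`i < r`), host `h`, class key `key` and symmetry factor `symFac = ∏_classes k_g!` (non-host classes; the
host alone):  **`Wn G · symFac ≤ Wn (part h) · (Σ_j M t (part j))^{r−1} · ∏_{i ≠ h} NZ (ext t (part i)) t (rootStep (part i)) · Wn (part i)`**
— the RECURSIVE INEQUALITY of the row: with `Wn (born) ≤ 1`, `Wn (renew G) = Wn G` (part 2) it telescopes over the
joins (`croots`) to «log #canonical placements ≤ Σ_joins [(r−1)·log S_J + Σ_{i≠h} log NZ_i − Σ_g log k_g!]», the input of
`HistorySiblingMassLayered.layered_cost_le_of_budget` (leaf-10 gen 2) with `S_J ≤ C·Q_t`, `log NZ_i ≤ d·log(2ext+1) +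
a_i·log Λ` and `Σ_i a_i ≤ partnerAges` (`HistoryJoins.partnerAges_add_eq_sum_clusterParts`).

PROOF.  `S G z` injects by `cfg` (the parts' relative placements; `eq_of_rel_eq`) into
`⋃_{p₀ ∈ S (part h) z} (forestSet ok touch h p₀).filter Sorted` with `ok i p := p ∈ Sany (part i)` and
`touch i p j q := q ∈ Sany (part j) ∧ zones share a block` (`cadm_merge_iff`, `junk_rel`, `rootAddr_eq_host`); each
fibre is bounded by `HistorySiblingCanon.card_sortedForest_mul_prod_factorial_le_pow_mul` with the slot bound
`#{p | ok i p ∧ touch i p j q} ≤ M t (part j) · NZ_i · Wn (part i)` (`card_slot_le`: a block `u` of `part j`'s zone, a root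
cell near `u`, a member of `S (part i) y`), `hok`∕`ht` from `part_eq_of_key_eq`, `hkey` from `eq_host_of_key_eq`.

HONEST SCOPE.  The telescoped closed form and the `exp(θm·F)·Λm^{partnerAges}` shape are part 4; the instantiation
of `zone`∕`M`∕`ext`∕`near`∕`NZ` on the torus carrier is rows (a)(b) + S6 pt 3.  NE7b NOT proved.  HONEST DEPENDENCY (cell):
continuum YM on T⁴ ⇐ BetaPertH ∧ nine spine estimates (0/9 proved); BetaPertH ⇐ (D1) ∧ (D4) ∧ CAP+tail.  This file
changes none of it.
-/

open Finset
open Literature.MathematicalPhysics.QuantumFieldTheory.Balaban1983to89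
open T4PersistenceDictionary T4PartnerMultiplicity T4BranchingRecordsGas
open Summit.QuantumFields.BalabanUV.T4Continuum.HistorySiblingSymmetry
open Summit.QuantumFields.BalabanUV.T4Continuum.HistorySiblingOrbits
open Summit.QuantumFields.BalabanUV.T4Continuum.HistorySiblingCanon
open Summit.QuantumFields.BalabanUV.T4Continuum.HistoryJoins
open Summit.QuantumFields.BalabanUV.T4Continuum.HistoryJoinsAdm

namespace Summit.QuantumFields.BalabanUV.T4Continuum.HistoryJoinsCount

noncomputable section

open scoped Classical

variable {ε γ β R : Type*} [DecidableEq β] [LinearOrder R] [Fintype γ] {D : ℕ}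
  (zone : ℕ → Gen ε → (Addr D → γ) → Finset β) (ρ : (Addr D → γ) → R) (c₀ : γ) (st : ε → ℕ)
  (X Y : Gen ε) (e : ε)

/-! ## §1 The predicates the generic layer is fed with -/

/-- a part's placement is admissible iff it is a canonically admissible junk placement of the part [folklore] -/
def okJ (i : Fin (npart st (Gen.merge X Y e))) (p : Addr D → γ) : Prop :=
  p ∈ Sany zone ρ c₀ st (part st (Gen.merge X Y e) i).2

/-- the touch relation: the parent's placement is admissible and the two zones share a block [folklore] -/
def touchJ (i : Fin (npart st (Gen.merge X Y e))) (p : Addr D → γ) (j : Fin (npart st (Gen.merge X Y e)))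
    (q : Addr D → γ) : Prop :=
  q ∈ Sany zone ρ c₀ st (part st (Gen.merge X Y e) j).2 ∧ touch0 zone st X Y e i p j q

/-- **THE SYMMETRY FACTOR** of the top join: `∏_classes (#class)!` (the host alone in its class). [folklore] -/
def symFac : ℝ :=
  ∏ k : Option (Fin (npart st (Gen.merge X Y e))),
    ((Fintype.card {i // key st X Y e i = k}).factorial : ℝ)

/-- the symmetry factor is positive [folklore] -/
theorem symFac_pos : 0 < symFac st X Y e :=
  prod_pos fun _ _ => by exact_mod_cast Nat.factorial_pos _

variable {zone ρ c₀ st X Y e}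

/-- `ok` reads the part only through its key [folklore] -/
theorem okJ_iff_of_key_eq {i j : Fin (npart st (Gen.merge X Y e))} (h : key st X Y e i = key st X Y e j)
    (p : Addr D → γ) : okJ zone ρ c₀ st X Y e i p ↔ okJ zone ρ c₀ st X Y e j p := by
  simp only [okJ, part_eq_of_key_eq st X Y e h]

/-- `touch` reads the parts only through their keys [folklore] -/
theorem touchJ_iff_of_key_eq {i i' j j' : Fin (npart st (Gen.merge X Y e))} (hi : key st X Y e i = key st X Y e i')
    (hj : key st X Y e j = key st X Y e j') (p q : Addr D → γ) :
    touchJ zone ρ c₀ st X Y e i p j q ↔ touchJ zone ρ c₀ st X Y e i' p j' q := by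
  simp only [touchJ, touch0, part_eq_of_key_eq st X Y e hi, part_eq_of_key_eq st X Y e hj]

/-! ## §2 The injection of `S (merge X Y e) z` into the sorted forest configurations over the host's placements -/

/-- the configuration of an admissible placement: every part is admissibly placed [folklore] -/
theorem cfg_mem_Sany {P : Addr D → γ} (hP : P ∈ Sany zone ρ c₀ st (Gen.merge X Y e))
    (i : Fin (npart st (Gen.merge X Y e))) : cfg c₀ st X Y e P i ∈ Sany zone ρ c₀ st (part st _ i).2 := by
  rw [mem_Sany] at hP ⊢
  refine ⟨junk_rel st hP.1 (t := st e) (by simpa [jparts] using part_mem st (Gen.merge X Y e) i), ?_⟩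
  exact ((cadm_merge_iff zone ρ c₀ st X Y e P).1 hP.2).2 i

omit [Fintype γ] in
/-- the host's relative placement keeps the root cell [folklore] -/
theorem evalA_cfg_host (P : Addr D → γ) :
    evalA c₀ (cfg c₀ st X Y e P (hostIdx st X Y e)) (rootAddr (part st _ (hostIdx st X Y e)).2) =
      evalA c₀ P (rootAddr (Gen.merge X Y e)) := by
  rw [cfg, evalA_rel, ← rootAddr_eq_host]

/-- **THE INJECTION**: `S (merge X Y e) z` maps injectively by `cfg` into the sorted forest configurations over the
host placements `p₀ ∈ S (host) z`. [folklore] -/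
theorem card_S_merge_le (z : γ) :
    (S zone ρ c₀ st (Gen.merge X Y e) z).card ≤
      ∑ p₀ ∈ S zone ρ c₀ st (part st _ (hostIdx st X Y e)).2 z,
        ((forestSet (okJ zone ρ c₀ st X Y e) (touchJ zone ρ c₀ st X Y e) (hostIdx st X Y e) p₀).filter
          fun c => Sorted (key st X Y e) ρ c).card := by
  refine le_trans (card_le_card_of_injOn (cfg c₀ st X Y e) (fun P hP => ?_) ?_) card_biUnion_le
  · -- maps into the union
    replace hP := Finset.mem_coe.1 hP
    have hany := mem_Sany_of_mem_S hP
    rw [mem_S] at hP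
    obtain ⟨hJ, hC, hz⟩ := hP
    obtain ⟨⟨par, hac, hpar⟩, hsorted⟩ : LocalTop zone ρ c₀ st (Gen.merge X Y e) P :=
      ((cadm_merge_iff zone ρ c₀ st X Y e P).1 hC).1
    refine Finset.mem_coe.2 (mem_biUnion.2 ⟨cfg c₀ st X Y e P (hostIdx st X Y e), ?_, ?_⟩)
    · rw [mem_S]
      have h1 := cfg_mem_Sany hany (hostIdx st X Y e)
      rw [mem_Sany] at h1
      exact ⟨h1.1, h1.2, by rw [evalA_cfg_host, hz]⟩
    · rw [mem_filter, mem_forestSet]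
      refine ⟨⟨rfl, par, hac, fun i hi => ⟨cfg_mem_Sany hany i, cfg_mem_Sany hany (par i), (hpar i hi).2⟩⟩, hsorted⟩
  · -- injective
    intro P hP P' hP' heq
    replace hP := Finset.mem_coe.1 hP
    replace hP' := Finset.mem_coe.1 hP'
    rw [mem_S] at hP hP'
    refine eq_of_rel_eq st hP.1 hP'.1 (st e) fun q hq => ?_
    obtain ⟨i, hi⟩ := exists_part_eq st (G := Gen.merge X Y e) (by simpa [jparts] using hq)
    have := congrFun heq i
    simp only [cfg, hi] at this
    exact this

/-! ## §3 The slot bound from the displayed laws -/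

variable (M : ℕ → Gen ε → ℕ) (ext : ℕ → Gen ε → ℝ) (near : β → ℕ → γ → ℕ → ℝ → Prop) (NZ : ℝ → ℕ → ℕ → ℕ)

/-- **THE SLOT BOUND**: the admissible placements of part `i` whose zone meets the zone of an admissibly placed part `j`
number at most `M t (part j) · NZ (ext t (part i)) t (rootStep (part i)) · Wn (part i)` — a block of `part j`'s zone, a
root cell near it, a member of `S (part i)` with that root. [folklore] -/
theorem card_slot_le
    (hcard : ∀ (t : ℕ) (Z : Gen ε) (p : Addr D → γ), p ∈ Sany zone ρ c₀ st Z → (zone t Z p).card ≤ M t Z)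
    (hloc : ∀ (t : ℕ) (Z : Gen ε) (p : Addr D → γ) (u : β), p ∈ Sany zone ρ c₀ st Z → u ∈ zone t Z p →
      near u t (evalA c₀ p (rootAddr Z)) Z.rootStep (ext t Z))
    (hNZ : ∀ (u : β) (t s : ℕ) (r : ℝ), (univ.filter fun y : γ => near u t y s r).card ≤ NZ r t s)
    (i j : Fin (npart st (Gen.merge X Y e))) (q : Addr D → γ) :
    (univ.filter fun p => okJ zone ρ c₀ st X Y e i p ∧ touchJ zone ρ c₀ st X Y e i p j q).card ≤
      M (st e) (part st _ j).2 *
        (NZ (ext (st e) (part st _ i).2) (st e) (part st _ i).2.rootStep * Wn zone ρ c₀ st (part st _ i).2) := by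
  set t := st e
  set Xi := (part st (Gen.merge X Y e) i).2
  set Xj := (part st (Gen.merge X Y e) j).2
  by_cases hq : q ∈ Sany zone ρ c₀ st Xj
  · -- one block `u` of `Xj`'s zone at a time
    have hone : ∀ u : β, (univ.filter fun p : Addr D → γ => p ∈ Sany zone ρ c₀ st Xi ∧ u ∈ zone t Xi p).card ≤
        NZ (ext t Xi) t Xi.rootStep * Wn zone ρ c₀ st Xi := by
      intro u
      have hsub : (univ.filter fun p : Addr D → γ => p ∈ Sany zone ρ c₀ st Xi ∧ u ∈ zone t Xi p) ⊆
          (univ.filter fun y : γ => near u t y Xi.rootStep (ext t Xi)).biUnion fun y => S zone ρ c₀ st Xi y := by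
        intro p hp
        rw [mem_filter] at hp
        obtain ⟨-, hp1, hp2⟩ := hp
        exact mem_biUnion.2 ⟨_, mem_filter.2 ⟨mem_univ _, hloc t Xi p u hp1 hp2⟩, mem_S_root hp1⟩
      refine (card_le_card hsub).trans (card_biUnion_le.trans ?_)
      refine (sum_le_sum fun y _ => card_S_le_Wn Xi y).trans ?_
      rw [sum_const, smul_eq_mul]
      exact Nat.mul_le_mul_right _ (hNZ u t _ _)
    have hsub : (univ.filter fun p => okJ zone ρ c₀ st X Y e i p ∧ touchJ zone ρ c₀ st X Y e i p j q) ⊆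
        (zone t Xj q).biUnion fun u =>
          univ.filter fun p : Addr D → γ => p ∈ Sany zone ρ c₀ st Xi ∧ u ∈ zone t Xi p := by
      intro p hp
      rw [mem_filter] at hp
      obtain ⟨-, hok, -, ⟨u, hu⟩⟩ := hp
      rw [mem_inter] at hu
      exact mem_biUnion.2 ⟨u, hu.2, mem_filter.2 ⟨mem_univ _, hok, hu.1⟩⟩
    refine (card_le_card hsub).trans (card_biUnion_le.trans ?_)
    refine (sum_le_sum fun u _ => hone u).trans ?_
    rw [sum_const, smul_eq_mul]
    exact Nat.mul_le_mul_right _ (hcard t Xj q hq)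
  · have : (univ.filter fun p => okJ zone ρ c₀ st X Y e i p ∧ touchJ zone ρ c₀ st X Y e i p j q) = ∅ := by
      refine filter_eq_empty_iff.2 fun p _ hp => hq hp.2.1
    rw [this, card_empty]
    exact Nat.zero_le _

/-! ## §4 The recursive inequality of the row -/

/-- **ONE JOIN OF THE SHAPE TREE COSTS `(Σ M)^{r−1} · ∏_{i≠h} NZ_i ∕ ∏_g k_g!`:**
`Wn (merge X Y e) · symFac ≤ Wn (host) · (Σ_j M t (part j))^{r−1} · ∏_{i ≠ h} NZ (ext t (part i)) t (rootStep (part i)) · Wn (part i)`.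
[folklore] -/
theorem Wn_merge_mul_symFac_le
    (hcard : ∀ (t : ℕ) (Z : Gen ε) (p : Addr D → γ), p ∈ Sany zone ρ c₀ st Z → (zone t Z p).card ≤ M t Z)
    (hloc : ∀ (t : ℕ) (Z : Gen ε) (p : Addr D → γ) (u : β), p ∈ Sany zone ρ c₀ st Z → u ∈ zone t Z p →
      near u t (evalA c₀ p (rootAddr Z)) Z.rootStep (ext t Z))
    (hNZ : ∀ (u : β) (t s : ℕ) (r : ℝ), (univ.filter fun y : γ => near u t y s r).card ≤ NZ r t s) :
    (Wn zone ρ c₀ st (Gen.merge X Y e) : ℝ) * symFac st X Y e ≤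
      Wn zone ρ c₀ st (part st _ (hostIdx st X Y e)).2 *
        ((∑ j, (M (st e) (part st (Gen.merge X Y e) j).2 : ℝ)) ^ (npart st (Gen.merge X Y e) - 1) *
          ∏ i : {i // i ≠ hostIdx st X Y e},
            ((NZ (ext (st e) (part st _ i.1).2) (st e) (part st _ i.1).2.rootStep : ℝ) *
              Wn zone ρ c₀ st (part st _ i.1).2)) := by
  set G := Gen.merge X Y e
  set h := hostIdx st X Y e
  set t := st e
  set A : Fin (npart st G) → ℝ := fun i =>
    (NZ (ext t (part st G i).2) t (part st G i).2.rootStep : ℝ) * Wn zone ρ c₀ st (part st G i).2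
  set B : Fin (npart st G) → ℝ := fun j => (M t (part st G j).2 : ℝ)
  set RHS := (∑ j, B j) ^ (npart st G - 1) * ∏ i : {i // i ≠ h}, A i.1
  have hRHS0 : 0 ≤ RHS :=
    mul_nonneg (pow_nonneg (sum_nonneg fun _ _ => Nat.cast_nonneg _) _)
      (prod_nonneg fun _ _ => mul_nonneg (Nat.cast_nonneg _) (Nat.cast_nonneg _))
  -- the fibre bound from the generic layer, uniformly in the host placement `p₀`
  have hfib : ∀ p₀ : Addr D → γ,
      (((forestSet (okJ zone ρ c₀ st X Y e) (touchJ zone ρ c₀ st X Y e) h p₀).filter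
          fun c => Sorted (key st X Y e) ρ c).card : ℝ) * symFac st X Y e ≤ RHS := by
    intro p₀
    have hmain := card_sortedForest_mul_prod_factorial_le_pow_mul (key := key st X Y e)
      (ok := okJ zone ρ c₀ st X Y e) (touch := touchJ zone ρ c₀ st X Y e) (h := h)
      (fun i hi => eq_host_of_key_eq st X Y e i hi) (fun i j hij p => okJ_iff_of_key_eq hij p)
      (fun i i' j j' hi hj p q => touchJ_iff_of_key_eq hi hj p q) p₀ ρ
      (fun i j => M t (part st G j).2 * (NZ (ext t (part st G i).2) t (part st G i).2.rootStep *
        Wn zone ρ c₀ st (part st G i).2))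
      (fun i _ j q => card_slot_le M ext near NZ hcard hloc hNZ i j q) A B
      (fun i _ j => by simp only [A, B]; push_cast; ring_nf; exact le_rfl)
    simpa [symFac, RHS, Fintype.card_fin] using hmain
  -- per root cell `z`
  have hz : ∀ z : γ, ((S zone ρ c₀ st G z).card : ℝ) * symFac st X Y e ≤ Wn zone ρ c₀ st (part st G h).2 * RHS := by
    intro z
    have h1 := card_S_merge_le (zone := zone) (ρ := ρ) (c₀ := c₀) (st := st) (X := X) (Y := Y) (e := e) z
    have h2 : (((S zone ρ c₀ st G z).card : ℕ) : ℝ) * symFac st X Y e ≤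
        ∑ p₀ ∈ S zone ρ c₀ st (part st G h).2 z,
          ((((forestSet (okJ zone ρ c₀ st X Y e) (touchJ zone ρ c₀ st X Y e) h p₀).filter
            fun c => Sorted (key st X Y e) ρ c).card : ℝ) * symFac st X Y e) := by
      rw [← sum_mul]
      exact mul_le_mul_of_nonneg_right (by exact_mod_cast h1) (symFac_pos st X Y e).le
    refine h2.trans ((sum_le_sum fun p₀ _ => hfib p₀).trans ?_)
    rw [sum_const, nsmul_eq_mul]
    exact mul_le_mul_of_nonneg_right (by exact_mod_cast card_S_le_Wn (part st G h).2 z) hRHS0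
  -- the width is attained (or `γ` is empty)
  rcases (univ : Finset γ).eq_empty_or_nonempty with hγ | hγ
  · have : Wn zone ρ c₀ st G = 0 := by simp [Wn, hγ]
    rw [this, Nat.cast_zero, zero_mul]
    exact mul_nonneg (Nat.cast_nonneg _) hRHS0
  · obtain ⟨z, -, hzmax⟩ := exists_mem_eq_sup univ hγ fun z => (S zone ρ c₀ st G z).card
    rw [Wn, hzmax]
    exact hz z

end

end Summit.QuantumFields.BalabanUV.T4Continuum.HistoryJoinsCount
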